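import Literature.AlgebraicGeometry.Motives.FamiliesVHSExteriorPower
import Literature.AlgebraicGeometry.Motives.HodgeStructureProdPolarization
import Literature.AlgebraicGeometry.Motives.FamiliesVHSComap
import Mathlib.LinearAlgebra.TensorProduct.Prod
import Mathlib.LinearAlgebra.Basis.Prod
import Mathlib.RingTheory.Finiteness.Prod
import Mathlib.Algebra.Category.ModuleCat.ChangeOfRings
import HarnessLib

/-!
# The direct sum `D₁ ⊕ D₂` of the data of two polarized variations of Hodge structure of the same weight: the local systems
# `V₁,ℤ ⊕ V₂,ℤ`, `V₁ ⊕ V₂`, the comparison `(V₁,ℤ ⊕ V₂,ℤ) ⊗ ℚ ≅ V₁ ⊕ V₂`, the fibrewise direct-sum Hodge structures and polarizations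

Topic `Literature/AlgebraicGeometry/Motives` (namespaces `Literature.AlgebraicGeometry.Motives.LocalSystem`, `….Motives.VHSData`), lane `lit-hodgefound`
(seat `p08`, row g56-#14).  DEFINITIONS WITH BODIES (`LocalSystem.prod`, the comparison `VHSData.prodRatIsoApp` ∕ `prodRatIso`, `VHSData.prod`) and their
API; no named fact, no instance, no notation (D-0026 net debt `0`).  Companion of `Motives/FamiliesVHSTensor` (`⊗`), `Motives/FamiliesVHSDual` (`∨`),
`Motives/FamiliesVHSHom` (`Hom`) and `Motives/FamiliesVHSExteriorPower` (`⋀ᵈ`): with it the additive ∕ tensor toolkit of VHS data is complete.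

PRINTED SOURCES.  P. Deligne, *Équations différentielles à points singuliers réguliers*, LNM 163 (1970), I.1: local systems form an abelian
`⊗`-category, direct sums fibrewise.  P. Deligne, *Théorie de Hodge II*, 2.1 (direct sums of Hodge structures of the same weight), 2.1.15 (direct sum
of polarizations); C. Voisin, *Hodge Theory I*, §7.1.2.  P. Griffiths, *Periods of integrals III*, §1 ∕ W. Schmid, *Variation of Hodge structure*, §2:
variations of Hodge structure of the same weight are stable under direct sums (e.g. the variation of a disjoint union ∕ a product family splits).

* §1 **`LocalSystem.prod V₁ V₂`** — fibre `V₁,x × V₂,x`, transport `γ_* × γ_*` (Mathlib `LinearMap.prodMap`); `rfl` API.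
* §2 **the comparison `(V₁,ℤ ⊕ V₂,ℤ) ⊗ ℚ ⥲ V₁ ⊕ V₂`**: `prodRatIsoApp` = Mathlib's `TensorProduct.prodRight` (`ℚ ⊗ (M₁ × M₂) ≃ (ℚ ⊗ M₁) × (ℚ ⊗ M₂)`) followed
  by `ratIso₁⁻¹ × ratIso₂⁻¹`; `1 ⊗ (m₁, m₂) ↦ (toRat m₁, toRat m₂)`; naturality along `Π₁(S)`; the natural isomorphism `prodRatIso`.
* §3 **`VHSData.prod D₁ D₂ : VHSData S k`** — `V₁,ℤ ⊕ V₂,ℤ`, `V₁ ⊕ V₂`, the comparison, on each fibre the direct-sum Hodge structure (the tree's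
  `HodgeStructure.prod`) polarized by `Q₁ ⊕ Q₂` (the tree's `Polarization.prod`), flat because both transports are isometries; integral fibres finitely
  generated free (`Module.Finite.prod`, `Module.Free.prod`).
* §4 API: `prod_toRat_apply` (`toRat (m₁, m₂) = (toRat m₁, toRat m₂)`), **`isHodgeAt_prod_iff`** (`(m₁, m₂)` is a Hodge class of level `p` of
  `D₁ ⊕ D₂` iff `m₁`, `m₂` are Hodge classes of level `p`: the tree's `mem_hodgeClasses_prod_iff`), transports, `prod_form_form`.

HONEST SCOPE: as for every `VHSData`, holomorphy and transversality are not recorded; same weight only (as for Hodge structures).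

## References

* [Deligne1970] P. Deligne, *Équations différentielles à points singuliers réguliers*, LNM 163 (1970), I.1.
* [DeligneHodgeII1971] P. Deligne, *Théorie de Hodge II*, Publ. Math. IHÉS 40 (1971), 2.1, 2.1.15.
* [VoisinHodgeI2002] C. Voisin, *Hodge Theory and Complex Algebraic Geometry I* (CUP, 2002), §7.1.2.
* [Griffiths1970] P. Griffiths, *Periods of integrals on algebraic manifolds III*, Publ. Math. IHÉS 38 (1970), §1.
* [Schmid1973] W. Schmid, *Variation of Hodge structure: the singularities of the period mapping*, Invent. Math. 22 (1973), §2.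
-/

noncomputable section

open CategoryTheory
open scoped TensorProduct ChangeOfRings

universe u

namespace Literature.AlgebraicGeometry.Motives

/-! ## §1 The direct sum of local systems -/

namespace LocalSystem

variable {R : Type u} [Ring R] {S : Type u} [TopologicalSpace S]

/-- **The direct sum `V₁ ⊕ V₂` of local systems** of `R`-modules: the functor `Π₁(S) ⥤ Mod_R` with value `V₁,x × V₂,x` and transport `γ_* × γ_*`
(Deligne 1970, I.1: local systems form an abelian category, sums fibrewise). [cite: Deligne1970, I.1] -/
def prod (V₁ V₂ : LocalSystem R S) : LocalSystem R S where
  obj x := ModuleCat.of R (V₁.obj x × V₂.obj x)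
  map g := ModuleCat.ofHom ((V₁.map g).hom.prodMap (V₂.map g).hom)
  map_id x := by
    ext : 1
    rw [ModuleCat.hom_ofHom, V₁.map_id, V₂.map_id, ModuleCat.hom_id, ModuleCat.hom_id, ModuleCat.hom_id, LinearMap.prodMap_id]
  map_comp f g := by
    ext : 1
    rw [ModuleCat.hom_ofHom, V₁.map_comp, V₂.map_comp, ModuleCat.hom_comp, ModuleCat.hom_comp, ModuleCat.hom_comp, ModuleCat.hom_ofHom,
      ModuleCat.hom_ofHom, LinearMap.prodMap_comp]

/-- The value of `V₁ ⊕ V₂` at a point of the fundamental groupoid. [cite: Deligne1970, I.1] -/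
@[simp] theorem prod_obj (V₁ V₂ : LocalSystem R S) (x : FundamentalGroupoid S) : (V₁.prod V₂).obj x = ModuleCat.of R (V₁.obj x × V₂.obj x) := rfl

/-- The fibre of `V₁ ⊕ V₂` at `s` is `V₁,s × V₂,s`. [cite: Deligne1970, I.1] -/
theorem prod_fiber (V₁ V₂ : LocalSystem R S) (s : S) : (V₁.prod V₂).fiber s = ModuleCat.of R (V₁.fiber s × V₂.fiber s) := rfl

/-- `V₁ ⊕ V₂` on morphisms is `V₁ × V₂` on morphisms. [cite: Deligne1970, I.1] -/
theorem prod_map_hom (V₁ V₂ : LocalSystem R S) {x y : FundamentalGroupoid S} (g : x ⟶ y) :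
    ((V₁.prod V₂).map g).hom = (V₁.map g).hom.prodMap (V₂.map g).hom := rfl

/-- **Transport in `V₁ ⊕ V₂` is the product of the transports.** [cite: Deligne1970, I.1] -/
theorem prod_transport (V₁ V₂ : LocalSystem R S) {s t : S} (γ : Path.Homotopic.Quotient s t) :
    (V₁.prod V₂).transport γ = (V₁.transport γ).prodMap (V₂.transport γ) := rfl

/-- Transport of a pair: `γ · (v₁, v₂) = (γ·v₁, γ·v₂)`. [cite: Deligne1970, I.1] -/
theorem prod_transport_mk (V₁ V₂ : LocalSystem R S) {s t : S} (γ : Path.Homotopic.Quotient s t) (v₁ : V₁.fiber s) (v₂ : V₂.fiber s) :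
    (V₁.prod V₂).transport γ (v₁, v₂) = (V₁.transport γ v₁, V₂.transport γ v₂) := rfl

/-- `⊕` commutes with pull-back of local systems. [cite: Deligne1970, I.1] -/
theorem prod_comap {S' : Type u} [TopologicalSpace S'] (f : C(S', S)) (V₁ V₂ : LocalSystem R S) :
    (V₁.comap f).prod (V₂.comap f) = (V₁.prod V₂).comap f := rfl

end LocalSystem

namespace VHSData

variable {S : Type} [TopologicalSpace S] {k : ℤ} (D₁ D₂ : VHSData S k)

/-! ## §2 The comparison `ℚ ⊗ (V₁,ℤ ⊕ V₂,ℤ) ⥲ V₁ ⊕ V₂` -/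

/-- **The comparison `ℚ ⊗_ℤ (V₁,ℤ,x × V₂,ℤ,x) ≅ V₁,x × V₂,x`** (component in `ModuleCat ℚ`): `ℚ ⊗` distributes over `×` (Mathlib
`TensorProduct.prodRight`), followed by `ratIso₁⁻¹ × ratIso₂⁻¹`. [cite: Schmid1973, §2 (`V_ℚ = V_ℤ ⊗ ℚ`)] [cite: Deligne1970, I.1] -/
def prodRatIsoApp (x : FundamentalGroupoid S) : ((D₁.VZ.prod D₂.VZ).baseChange (Int.castRingHom ℚ)).obj x ≅ (D₁.V.prod D₂.V).obj x :=
  (TensorProduct.prodRight ℤ ℚ ℚ (D₁.VZ.obj x) (D₂.VZ.obj x)).toModuleIso ≪≫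
    ((D₁.ratIso.app x).toLinearEquiv.symm.prodCongr (D₂.ratIso.app x).toLinearEquiv.symm).toModuleIso

/-- **`1 ⊗ (m₁, m₂) ↦ (toRat m₁, toRat m₂)`.** [cite: Schmid1973, §2 (`V_ℚ = V_ℤ ⊗ ℚ`)] -/
theorem prodRatIsoApp_hom_one_tmul (x : FundamentalGroupoid S) (m₁ : D₁.VZ.obj x) (m₂ : D₂.VZ.obj x) :
    (D₁.prodRatIsoApp D₂ x).hom ((1 : ℚ) ⊗ₜ[ℤ,Int.castRingHom ℚ] ((m₁, m₂) : (D₁.VZ.prod D₂.VZ).obj x)) =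
      ((D₁.toRat x.as m₁, D₂.toRat x.as m₂) : (D₁.V.prod D₂.V).obj x) := rfl

/-- **Naturality of the comparison** along `g : x ⟶ y` in `Π₁(S)` (componentwise naturality of `toRat`, `map_hom_toRat`).
[cite: Deligne1970, I.1] [cite: Schmid1973, §2] -/
theorem prodRatIsoApp_naturality {x y : FundamentalGroupoid S} (g : x ⟶ y) :
    ((D₁.VZ.prod D₂.VZ).baseChange (Int.castRingHom ℚ)).map g ≫ (D₁.prodRatIsoApp D₂ y).hom =
      (D₁.prodRatIsoApp D₂ x).hom ≫ (D₁.V.prod D₂.V).map g := by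
  apply ModuleCat.ExtendScalars.hom_ext
  intro m
  obtain ⟨m₁, m₂⟩ := m
  change ((D₁.toRat y.as ((D₁.VZ.map g).hom m₁), D₂.toRat y.as ((D₂.VZ.map g).hom m₂)) : (D₁.V.prod D₂.V).obj y) =
    ((D₁.V.map g).hom (D₁.toRat x.as m₁), (D₂.V.map g).hom (D₂.toRat x.as m₂))
  rw [D₁.map_hom_toRat, D₂.map_hom_toRat]

/-- **The comparison isomorphism of local systems `(V₁,ℤ ⊕ V₂,ℤ) ⊗ ℚ ≅ V₁ ⊕ V₂`** (natural in the point of `Π₁(S)`). [cite: Deligne1970, I.1] [cite: Schmid1973, §2] -/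
def prodRatIso : (D₁.VZ.prod D₂.VZ).baseChange (Int.castRingHom ℚ) ≅ D₁.V.prod D₂.V :=
  NatIso.ofComponents (fun x => D₁.prodRatIsoApp D₂ x) fun g => D₁.prodRatIsoApp_naturality D₂ g

/-! ## §3 The direct sum of two VHS data of the same weight -/

/-- **The direct sum `D₁ ⊕ D₂` of the data of two polarized variations of Hodge structure of the same weight `k`** (Griffiths 1970 §1 ∕ Schmid 1973
§2; Deligne, Hodge II 2.1): integral and rational local systems `V₁,ℤ ⊕ V₂,ℤ`, `V₁ ⊕ V₂` (§1), comparison (§2), on each fibre the direct-sum Hodge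
structure (`HodgeStructure.prod`) polarized by `Q₁ ⊕ Q₂` (`Polarization.prod`, Hodge II 2.1.15), flat since both transports are isometries; integral
fibres finitely generated free. [cite: Griffiths1970, §1] [cite: Schmid1973, §2] [cite: DeligneHodgeII1971, 2.1 and 2.1.15] [cite: VoisinHodgeI2002, §7.1.2] -/
def prod : VHSData S k where
  VZ := D₁.VZ.prod D₂.VZ
  V := D₁.V.prod D₂.V
  ratIso := (D₁.prodRatIso D₂).symm
  hodge s := (D₁.hodge s).prod (D₂.hodge s)
  form s := (D₁.form s).prod (D₂.form s)
  transport_form s t γ x y := by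
    change ((D₁.form t).prod (D₂.form t)).form ((D₁.V.transport γ).prodMap (D₂.V.transport γ) x)
        ((D₁.V.transport γ).prodMap (D₂.V.transport γ) y) = ((D₁.form s).prod (D₂.form s)).form x y
    rw [HodgeStructure.Polarization.prod_form_apply, HodgeStructure.Polarization.prod_form_apply, LinearMap.prodMap_apply,
      LinearMap.prodMap_apply, D₁.transport_form, D₂.transport_form]
  finite_free s := by
    haveI := D₁.finite s
    haveI := D₂.finite s
    haveI := D₁.free s
    haveI := D₂.free s
    exact ⟨Module.Finite.prod, Module.Free.prod ℤ _ _⟩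

/-! ## §4 API -/

/-- The integral local system of `D₁ ⊕ D₂` is `V₁,ℤ ⊕ V₂,ℤ`. [cite: Deligne1970, I.1] -/
@[simp] theorem prod_VZ : (D₁.prod D₂).VZ = D₁.VZ.prod D₂.VZ := rfl

/-- The rational local system of `D₁ ⊕ D₂` is `V₁ ⊕ V₂`. [cite: Deligne1970, I.1] -/
@[simp] theorem prod_V : (D₁.prod D₂).V = D₁.V.prod D₂.V := rfl

/-- The Hodge structure of `D₁ ⊕ D₂` at `s` is the direct-sum Hodge structure. [cite: DeligneHodgeII1971, 2.1] -/
theorem prod_hodge (s : S) : (D₁.prod D₂).hodge s = (D₁.hodge s).prod (D₂.hodge s) := rfl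

/-- The polarization form of `D₁ ⊕ D₂`: `(Q₁ ⊕ Q₂)((v, w), (v', w')) = Q₁(v, v') + Q₂(w, w')`. [cite: DeligneHodgeII1971, 2.1.15] -/
theorem prod_form_form (s : S) (x y : D₁.V.fiber s × D₂.V.fiber s) :
    ((D₁.prod D₂).form s).form x y = (D₁.form s).form x.1 y.1 + (D₂.form s).form x.2 y.2 := rfl

/-- Rational transport of `D₁ ⊕ D₂` is the product of the transports. [cite: Deligne1970, I.1] -/
theorem prod_V_transport {s t : S} (γ : Path.Homotopic.Quotient s t) :
    (D₁.prod D₂).V.transport γ = (D₁.V.transport γ).prodMap (D₂.V.transport γ) := rfl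

/-- Integral transport of `D₁ ⊕ D₂` is the product of the integral transports. [cite: Deligne1970, I.1] -/
theorem prod_VZ_transport {s t : S} (γ : Path.Homotopic.Quotient s t) :
    (D₁.prod D₂).VZ.transport γ = (D₁.VZ.transport γ).prodMap (D₂.VZ.transport γ) := rfl

/-- **`toRat (m₁, m₂) = (toRat m₁, toRat m₂)`**: the comparison of `D₁ ⊕ D₂` is componentwise. [cite: Schmid1973, §2 (`V_ℚ = V_ℤ ⊗ ℚ`)] -/
theorem prod_toRat_apply (s : S) (m₁ : D₁.VZ.fiber s) (m₂ : D₂.VZ.fiber s) :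
    (D₁.prod D₂).toRat s (m₁, m₂) = ((D₁.toRat s m₁, D₂.toRat s m₂) : D₁.V.fiber s × D₂.V.fiber s) := rfl

/-- **Hodge classes of a direct sum are pairs of Hodge classes**: `(m₁, m₂)` is an integral Hodge class of level `p` of `D₁ ⊕ D₂` at `s` iff `m₁` and
`m₂` are integral Hodge classes of level `p` of `D₁` and `D₂` (the tree's `mem_hodgeClasses_prod_iff`). [cite: DeligneHodgeII1971, 2.1] [cite: CattaniDeligneKaplan1995, §1] -/
theorem isHodgeAt_prod_iff (s : S) (p : ℤ) (m₁ : D₁.VZ.fiber s) (m₂ : D₂.VZ.fiber s) :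
    (D₁.prod D₂).IsHodgeAt s p (m₁, m₂) ↔ D₁.IsHodgeAt s p m₁ ∧ D₂.IsHodgeAt s p m₂ := by
  rw [IsHodgeAt, prod_toRat_apply]
  exact HodgeStructure.mem_hodgeClasses_prod_iff (D₁.hodge s) (D₂.hodge s)

/-- Pull-back commutes with direct sums on fibres, transports, Hodge structures and forms; stated on `toRat`. [cite: Deligne1970, I.1] -/
theorem comap_prod_toRat {S' : Type} [TopologicalSpace S'] (f : C(S', S)) (s' : S') :
    ((D₁.comap f).prod (D₂.comap f)).toRat s' = ((D₁.prod D₂).comap f).toRat s' := rfl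

end VHSData

end Literature.AlgebraicGeometry.Motives

end
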